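import Literature.Analysis.FluidPDE.TypeIAncientMild
import Literature.Analysis.FluidPDE.TypeIAncientMildClassical
import HarnessLib

/-!
# `SpiralScalingLiouville` (stmt-NavierStokesRegularity-8216), line `registered` (birth skeleton):
# stub `stub_rssProfileSystem` — the rotated Leray profile system at `t = −1`

For an element `u` of the Type-I KNSS-mild ancient class `A_C` (`IsTypeIAncientMild C u`: jointly
smooth on `t < 0`, divergence-free slices, Oseen integral identity between all `s < t < 0`,
`‖u(t,x)‖ ≤ C/√(−t)`) annihilated on `t < 0` by the spiral-scaling generator in normal form
`∇u·(x + Ax) + u + 2t∂ₜu − Au = 0`, the slice `U = u(−1, ·)` solves, with the KNSS pressure slice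
`P = p(−1, ·)` (a `C¹`, indeed smooth, function), the rotated Leray profile system
`−ΔU + ½U + ½∇U·(y + Ay) − ½AU + (U·∇)U + ∇P = 0` (Pineau–Vicol 2026, (1.7)→(1.8) with the matrix
`A` in place of `αJ`; Leray 1934, (3.12) for `A = 0`).

Proof: `u` is a classical Navier–Stokes solution on the window `(−2, 0)` for some smooth pressure
`p` (`IsTypeIAncientMild.exists_isClassicalNSSolutionOn_Ioo`); at the interior time `t = −1` the
window time derivative is the two-sided one (`timeDerivWithin_of_mem_interior`), so
`∂ₜu(−1) + (U·∇)U = ΔU − ∇P`; the generator at `t = −1` gives `∂ₜu(−1) = ½(∇U·(y + Ay) + U − AU)`;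
substitute.

## References

* B. Pineau, V. Vicol, arXiv:2607.09619 (2026), (1.7)–(1.8), p. 3. [PineauVicol2026]
* J. Leray, Acta Math. 63 (1934) 193–248, (3.12). [Leray1934]
-/

noncomputable section

-- the summit and its single problem share the name (D-0017 nested layout)
set_option linter.dupNamespace false

open Set Function
open scoped ContDiff Laplacian
open Literature.Analysis.FluidPDE

namespace Summit.NavierStokesRegularity.NavierStokesRegularity.Theorems.SpiralScalingLiouville.Birth

/-- Local notation for physical space `ℝ³`. -/
local notation "E3" => EuclideanSpace ℝ (Fin 3)

/-- **The rotated Leray profile system at `t = −1` for an element of `A_C` annihilated by the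
spiral-scaling generator** (Pineau–Vicol (1.8) with a matrix rate; Leray 1934 (3.12) for `A = 0`).
If `u ∈ A_C` (`IsTypeIAncientMild C u`) satisfies `∇u·(x + Ax) + u + 2t∂ₜu − Au = 0` on `t < 0`,
then the slice `U = u(−1, ·)` solves, for some `C¹` pressure profile `P` (the KNSS pressure at
`t = −1`), `−ΔU + ½U + ½∇U·(y + Ay) − ½AU + (U·∇)U + ∇P = 0` pointwise on `ℝ³`: the classical
Navier–Stokes equation of the gauge class gives `∂ₜu = Δu − (u·∇)u − ∇p` with the two-sided time
derivative at the interior time `−1`, and the generator gives `∂ₜu(−1) = ½(∇U·(y + Ay) + U − AU)`.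
[cite: PineauVicol2026, (1.8) (arXiv:2607.09619 p. 3)] -/
theorem stub_rssProfileSystem :
    ∀ (C : ℝ) (u : ℝ → E3 → E3), IsTypeIAncientMild C u →
      ∀ A : E3 →L[ℝ] E3,
        (∀ t < 0, ∀ x, fderiv ℝ (u t) x (x + A x) + u t x + (2 * t) • timeDeriv u t x - A (u t x) = 0) →
        ∃ P : E3 → ℝ, ContDiff ℝ 1 P ∧
          ∀ y, -((Δ (u (-1))) y) + (1 / 2 : ℝ) • u (-1) y + (1 / 2 : ℝ) • fderiv ℝ (u (-1)) y (y + A y)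
            - (1 / 2 : ℝ) • A (u (-1) y) + convect (u (-1)) (u (-1)) y + gradient P y = 0 := by
  intro C u hu A hgen
  -- `u` is a classical Navier–Stokes solution (`ν = 1`, no force) on the window `(-2, 0)`
  obtain ⟨p, hcl⟩ := hu.exists_isClassicalNSSolutionOn_Ioo (t₀ := -2) (by norm_num)
  have hmem : (-1 : ℝ) ∈ Ioo (-2 : ℝ) 0 := ⟨by norm_num, by norm_num⟩
  refine ⟨p (-1), contDiff_infty.1 (hcl.smooth_pressure.contDiff_slice hmem) 1, fun y => ?_⟩
  -- the momentum equation at the interior time `t = -1`, with the two-sided time derivative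
  have hmom := hcl.momentum (-1) hmem y
  have hint : (-1 : ℝ) ∈ interior (Ioo (-2 : ℝ) 0) := by rwa [isOpen_Ioo.interior_eq]
  have hzero : (0 : ℝ → E3 → E3) (-1) y = 0 := rfl
  rw [timeDerivWithin_of_mem_interior hint y, one_smul, hzero, add_zero] at hmom
  -- the generator at `t = -1`: `∇U·(y + Ay) + U - 2 ∂ₜu(-1) - AU = 0`
  have hg := hgen (-1) (by norm_num) y
  have h2 : (2 * (-1 : ℝ)) • timeDeriv u (-1) y = (-2 : ℝ) • timeDeriv u (-1) y := by norm_num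
  rw [h2] at hg
  -- substitute: goal = ½ • generator + (momentum − momentum), pure linear algebra in `E3`
  linear_combination (norm := module) (1 / 2 : ℝ) • hg + hmom

end Summit.NavierStokesRegularity.NavierStokesRegularity.Theorems.SpiralScalingLiouville.Birth

end
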